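import Summits.QuantumFields.YangMills.Theorems.BalabanUVNodesN11PlaqSmallOfSect3Events
import Summits.QuantumFields.YangMills.Theorems.BalabanUVNodesN11NoExpansionNumerics

/-!
# DAG node N11 — THE FOUR DISPLAYED NUMERIC ROWS OF `…N11PlaqSmallOfSect3Events` REDUCED TO dag-n11-w3's SCALAR ROWS: the cube-size letter from `(d+4)L + 3 ≤ L·M₂`,
# `0 < sideD` from `1 ≤ M`, the nesting from `L·M₂ ∣ M`, and [B7] Prop. 2's two thresholds at `ε_{k+1}∕L²` from the same thresholds at `ε_{k+1}`

HEADER — WORK-UNIT METADATA.  Cell `pub-ymgap`, YM-PLAN Track A (HUMAN RULING D-0062), width seat `pub-ymgap-dag-n11-w2` (g4; WIDTH SEAT 2∕4 on NODE N11 [B14] =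
[Balaban1988Convergent] = [III]), route `BalabanUVNodes` (rev 29).  Helper lane of K1⁷ `StabilityBAtRecordR13SepCoPH` = stmt-QuantumFields-20542 (the jail key of this
seat; K1⁹ stmt-QuantumFields-27364 `…SepCoPHV` is the face of record — MIS-KEY∕VALID rule R463 (4)(a): valid lineage by name), filed `--kind proof --supports
stmt-QuantumFields-20542 --as helper`, COUNT-NEUTRAL.  [B7] = [Balaban1985Averaging].

WHY THIS FILE.  This seat's `…N11PlaqSmallOfSect3Events` (p641510) — consumed by dag-n08-w2 g10's `…AtRegionsOfNesting` (p642434) for the support clause of the central-window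
road — displays four numeric rows: the cube-size letter `hR : 3L^{k+1} + ((d+4)L+2)·Σ_{l<k}L^l + 2 ≤ sideχ`, `hD : 0 < sideD`, and [B7] Prop. 2's thresholds `hα3`∕`hα2` at
`α₀ := ε_{k+1}∕L²`.  dag-n11-w3 g3's `…N11NoExpansionNumerics` reduced the -d lane's per-level rows `hR`∕`h3`∕`hε`∕`hε3`∕`hε2` to SCALAR conditions (`(d+4)L+3 ≤ L·M₂`,
`3M₁ ≤ L·M₂`, the window rows at the global constant or at the edge).  THIS FILE puts F12's four rows on the SAME scalars: §1 the cube-size letter from `(d+4)L+3 ≤ L·M₂`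
(n11-w3's `geom_sum_succ_le_pow`, by name; `R_{k+1} ≥ 1` by `B14SeparationOfRecord.one_le_RkOfRecord`, `L ≥ 2` by n11-w3's `two_le_L`); §2 `0 < sideD` from `1 ≤ M` and the
nesting `sideχ ∣ sideD` from `L·M₂ ∣ M` (the `∣`-form sibling of dag-n11-w4's `dCubeSide_eq_cubeSide_mul`); §3 the two Prop.-2 thresholds at `ε∕L²` from the thresholds at `ε`
(`ε∕L² ≤ ε`); §4 the composition.  The covering row `hcov` stays a binder (dag-n11-w4's `…CubeCoverRowOfNesting` ∕ dag-n08-w2's §1 supply it from `L·M₂ ∣ M` + `PartCompat₁₃`).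

WHAT THIS FILE PROVES (0 `sorry`, 0 `def`).
§1 `collar3_le_cubeSide_of` (`2 ≤ L`, `(d+4)L+3 ≤ L·M₂`, `1 ≤ R` ⇒ `3L^{k+1} + ((d+4)L+2)·Σ_{l<k}L^l + 2 ≤ cubeSide L M₂ R (k+1)`) · ★ `collar3_le_sideχ_of` (at def-T's `sideχ`).
§2 `sideD_pos_of_one_le` (`1 ≤ M ⇒ 0 < sideD`) · `sideχ_dvd_sideD_of_dvd` (`L·M₂ ∣ M ⇒ sideχ ∣ sideD`).
§3 `prop2_row3_div_sq_of` · `prop2_row2_div_sq_of` (the thresholds at `ε∕L²` from those at `ε`, `0 ≤ ε`, `1 ≤ L`).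
§4 ★★ `plaqHol_small_near_of_wOfRecord_ne_zero_of_scalars` — `…PlaqSmallOfSect3Events.plaqHol_small_near_of_wOfRecord_ne_zero` with `hD`, `hR`, `hα3`, `hα2` REPLACED by
   `1 ≤ M`, `(d+4)L+3 ≤ L·M₂` and the two Prop.-2 thresholds AT `ε_{k+1}` (n11-w3's row shapes at `j = k+1`).

HONEST FRAMING.  Helper lane, count-neutral; elementary arithmetic on def-T's sides + by-name composition; `hcov`, `0 < ε_{k+1}`, the two thresholds at `ε_{k+1}` and the scalars stay
DISPLAYED; NO estimate of [III] asserted; N11 NOT discharged; K1⁷ ∕ K1⁹ NOT closed, no registered stub touched; counts unmoved (typed 28∕28 · discharged 5∕27 · A 5∕28).  One finite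
four-torus programme at fixed `ε = L^{−K}` — NOT ℝ⁴, NOT OS, NOT a mass gap, NOT Clay.  No `sorry`, `axiom`, `def`, `instance`, `notation`.
Sources: [III] (2.1) p.254, (2.4)–(2.5) p.255, (2.13) pp.256–257, (2.17) p.257, (3.2)–(3.5) p.265; [B7] Prop. 2 (52)–(54) p.26; [Balaban1987RG1] (0.1) p.251, (0.4) p.253.
-/

noncomputable section

open scoped BigOperators

namespace Summit.QuantumFields.YangMills.Theorems.BalabanUVNodesN11PlaqSmallOfSect3EventsNumerics

open Literature.MathematicalPhysics.QuantumFieldTheory.Balaban1983to89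
open T4Continuum Node00
open ExpMeanLog (deltaSU)
open B14.Eq218Concrete (cubesIn)
open B15DeterminingSets (embIter)
open B14SeparationOfRecord (one_le_RkOfRecord)
open Summit.QuantumFields.YangMills.Theorems.BalabanUVNodesN11NoExpansionNumerics (geom_sum_succ_le_pow two_le_L)
open Summit.QuantumFields.YangMills.Theorems.BalabanUVNodesN11PlaqSmallOfSect3Events (plaqHol_small_near_of_wOfRecord_ne_zero)

/-! ## §1  The cube-size letter of F12 from `(d+4)L + 3 ≤ L·M₂` -/

section Arithmetic

/-- **THE `3L^{k+1}`-COLLAR FITS IN THE χ-CUBE**: `2 ≤ L`, `(d+4)L + 3 ≤ L·M₂`, `1 ≤ R` ⇒ `3L^{k+1} + ((d+4)L+2)·Σ_{l<k}L^l + 2 ≤ cubeSide L M₂ R (k+1) = L^{k+2}M₂R`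
(`Σ_{l<k}L^l + 1 ≤ L^k`, so the left side is at most `((d+7)L+2)·L^k ≤ ((d+4)L+3)·L·L^k`). [cite: Balaban1988Convergent, (2.17) p.257, (3.2) p.265; Balaban1985Averaging, Prop. 2 p.26 (bookkeeping)] -/
theorem collar3_le_cubeSide_of {L d M₂ R : ℕ} (hL : 2 ≤ L) (hM : (d + 4) * L + 3 ≤ L * M₂) (hR : 1 ≤ R) (k : ℕ) :
    3 * L ^ (k + 1) + ((d + 4) * L + 2) * (∑ l ∈ Finset.range k, L ^ l) + 2 ≤ cubeSide L M₂ R (k + 1) := by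
  have hS := geom_sum_succ_le_pow hL k
  have hA : 1 ≤ L ^ k := Nat.one_le_pow k L (by omega)
  set A := L ^ k with hAdef
  set S := ∑ l ∈ Finset.range k, L ^ l with hSdef
  have h1 : L ^ (k + 1) = L * A := by rw [pow_succ, mul_comm]
  have h2 : cubeSide L M₂ R (k + 1) = L * (L * M₂) * A * R := by
    unfold cubeSide
    rw [pow_succ, pow_succ]
    ring
  rw [h1, h2]
  -- `S + 1 ≤ A`: the sum term is at most `((d+4)L+2)·(A − 1)`
  have hS' : ((d + 4) * L + 2) * S + ((d + 4) * L + 2) ≤ ((d + 4) * L + 2) * A := by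
    have := Nat.mul_le_mul_left ((d + 4) * L + 2) hS
    rw [Nat.mul_add, Nat.mul_one] at this
    exact this
  -- `3LA + ((d+4)L+2)A ≤ ((d+4)L+3)·L·A` for `L ≥ 2`
  have hmain : 3 * (L * A) + ((d + 4) * L + 2) * A ≤ L * (L * M₂) * A := by
    have e1 : 3 * (L * A) + ((d + 4) * L + 2) * A = ((d + 7) * L + 2) * A := by ring
    have e2 : (d + 7) * L + 2 ≤ L * ((d + 4) * L + 3) := by
      have hLL : 2 * L ≤ L * L := Nat.mul_le_mul_right L hL
      have h3 : (d + 4) * (2 * L) ≤ (d + 4) * (L * L) := Nat.mul_le_mul_left _ hLL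
      have h8 : 2 ≤ (d + 4) * L := le_trans (by norm_num : 2 ≤ 4 * 2) (Nat.mul_le_mul (by omega) hL)
      nlinarith [h3, h8]
    have e3 : L * ((d + 4) * L + 3) ≤ L * (L * M₂) := Nat.mul_le_mul_left _ hM
    rw [e1]
    calc ((d + 7) * L + 2) * A ≤ (L * ((d + 4) * L + 3)) * A := Nat.mul_le_mul_right _ e2
      _ ≤ (L * (L * M₂)) * A := Nat.mul_le_mul_right _ e3
  have hRm : L * (L * M₂) * A ≤ L * (L * M₂) * A * R := Nat.le_mul_of_pos_right _ hR
  omega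

end Arithmetic

/-! ## §2  Positivity and nesting of def-T's sides; the letter at the record -/

section Sides

variable (F : T4Family) (ν : Stage7Numerics) (M : ℕ) (p : B12.RunParams) (g : ℕ → ℝ) (k : ℕ)

/-- **★ F12's CUBE-SIZE LETTER FROM `(d+4)L + 3 ≤ L·M₂`** (at def-T's `sideχ = cubeSide L M₂ R_{k+1} (k+1)`; `R_{k+1} ≥ 1`, `L ≥ 2`).
[cite: Balaban1988Convergent, (2.5) p.255, (2.17) p.257, (3.2) p.265 (bookkeeping)] -/
theorem collar3_le_sideχ_of (hM : ((F.P p.K).d + 4) * (F.P p.K).L + 3 ≤ (F.P p.K).L * ν.M₂) :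
    3 * (F.P p.K).L ^ (k + 1) + (((F.P p.K).d + 4) * (F.P p.K).L + 2) * (∑ l ∈ Finset.range k, (F.P p.K).L ^ l) + 2 ≤ sideχ F ν p g k :=
  collar3_le_cubeSide_of (two_le_L p.K) hM (one_le_RkOfRecord (L := (F.P p.K).L) (F.P p.K).L_pos _ _) k

/-- `0 < sideD` once `1 ≤ M` (`sideD = L^{k+1}·M·R_{k+1}`, `L ≥ 1`, `R_{k+1} ≥ 1`). [cite: Balaban1988Convergent, (2.1) p.254, (2.5) p.255 (bookkeeping)] -/
theorem sideD_pos_of_one_le (hM : 1 ≤ M) : 0 < sideD F ν M p g k := by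
  unfold sideD dCubeSide
  have hL : 1 ≤ (F.P p.K).L := (F.P p.K).L_pos
  have h1 : 1 ≤ (F.P p.K).L ^ (k + 1) := Nat.one_le_pow _ _ hL
  have h2 := one_le_RkOfRecord (L := (F.P p.K).L) hL ν.r (g (k + 1))
  positivity

/-- **THE PARTITIONS ARE NESTED**: `L·M₂ ∣ M ⇒ sideχ ∣ sideD` (`sideχ = (L^{k+1}R_{k+1})·(L·M₂)`, `sideD = (L^{k+1}R_{k+1})·M`; the `∣`-form sibling of dag-n11-w4's
`dCubeSide_eq_cubeSide_mul`). [cite: Balaban1988Convergent, (2.13) pp.256-257, (2.17) p.257 (bookkeeping)] -/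
theorem sideχ_dvd_sideD_of_dvd (h : (F.P p.K).L * ν.M₂ ∣ M) : sideχ F ν p g k ∣ sideD F ν M p g k := by
  unfold sideχ sideD cubeSide dCubeSide
  have e1 : (F.P p.K).L ^ (k + 1 + 1) * ν.M₂ * RkOfRecord (F.P p.K).L ν.r (g (k + 1)) =
      ((F.P p.K).L ^ (k + 1) * RkOfRecord (F.P p.K).L ν.r (g (k + 1))) * ((F.P p.K).L * ν.M₂) := by rw [pow_succ]; ring
  have e2 : (F.P p.K).L ^ (k + 1) * M * RkOfRecord (F.P p.K).L ν.r (g (k + 1)) =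
      ((F.P p.K).L ^ (k + 1) * RkOfRecord (F.P p.K).L ν.r (g (k + 1))) * M := by ring
  rw [e1, e2]
  exact mul_dvd_mul_left _ h

end Sides

/-! ## §3  [B7] Prop. 2's thresholds at `ε∕L²` from the thresholds at `ε` -/

section Thresholds

/-- The third-order threshold at `ε∕L²` from the one at `ε`: `143c·ε ≤ 1∕3`, `0 ≤ ε`, `1 ≤ L` ⇒ `143c·(ε∕L²) ≤ 1∕3`. [cite: Balaban1985Averaging, Prop. 2 (52)-(54) p.26 (bookkeeping)] -/
theorem prop2_row3_div_sq_of {d L : ℕ} (hL : 1 ≤ L) {ε : ℝ} (hε : 0 ≤ ε)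
    (h3 : (143 * ((((d + 4 : ℕ) : ℝ)) ^ 2 / 4) ^ 2) * ε ≤ 1 / 3) :
    (143 * ((((d + 4 : ℕ) : ℝ)) ^ 2 / 4) ^ 2) * (ε / (L : ℝ) ^ 2) ≤ 1 / 3 := by
  have hL1 : (1 : ℝ) ≤ (L : ℝ) ^ 2 := by
    have : (1 : ℝ) ≤ (L : ℝ) := by exact_mod_cast hL
    nlinarith
  have hdiv : ε / (L : ℝ) ^ 2 ≤ ε := div_le_self hε hL1
  have hc : (0 : ℝ) ≤ 143 * ((((d + 4 : ℕ) : ℝ)) ^ 2 / 4) ^ 2 := by positivity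
  exact (mul_le_mul_of_nonneg_left hdiv hc).trans h3

/-- The second threshold at `ε∕L²` from the one at `ε`: `2ε ≤ B`, `0 ≤ ε`, `1 ≤ L` ⇒ `2(ε∕L²) ≤ B`. [cite: Balaban1985Averaging, Prop. 2 (52)-(54) p.26 (bookkeeping)] -/
theorem prop2_row2_div_sq_of {L : ℕ} (hL : 1 ≤ L) {ε B : ℝ} (hε : 0 ≤ ε) (h2 : 2 * ε ≤ B) : 2 * (ε / (L : ℝ) ^ 2) ≤ B := by
  have hL1 : (1 : ℝ) ≤ (L : ℝ) ^ 2 := by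
    have : (1 : ℝ) ≤ (L : ℝ) := by exact_mod_cast hL
    nlinarith
  have hdiv : ε / (L : ℝ) ^ 2 ≤ ε := div_le_self hε hL1
  linarith

end Thresholds

/-! ## §4  F12's support clause on dag-n11-w3's scalars -/

section Record

variable (F : T4Family) (N : ℕ) [NeZero N] (ν : Stage7Numerics) (M : ℕ) (p : B12.RunParams) (g : ℕ → ℝ)

/-- **★★ THE SUPPORT CLAUSE IN PLAQUETTE CURRENCY AT THE BONDS MEETING `Ω_{k+1}(s′)`, ON SCALAR NUMERICS**: `…PlaqSmallOfSect3Events.plaqHol_small_near_of_wOfRecord_ne_zero` with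
its rows `hD`, `hR`, `hα3`, `hα2` REPLACED by `1 ≤ M`, `(d+4)L + 3 ≤ L·M₂` and [B7] Prop. 2's two thresholds AT `ε_{k+1}` (dag-n11-w3's row shapes at `j = k+1`); displayed
besides: `0 < ε_{k+1}`, the covering row `hcov` (dag-n11-w4 ∕ dag-n08-w2: from `L·M₂ ∣ M` + `PartCompat₁₃`).  Conclusion VERBATIM: `|U(∂q) − 1| < 4·(2δ_k) + 2ε_{k+1}∕L²` for
every `k`-plaquette `q` in the three blocks of a coarse bond with an endpoint in `Ω_{k+1}(s′)`, wherever `w_k(s′)(U,V′) ≠ 0`.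
[cite: Balaban1988Convergent, (3.2)-(3.5) p.265, p.267; Balaban1985Averaging, Prop. 2 (52)-(54) p.26; Balaban1987RG1, (0.4) p.253] -/
theorem plaqHol_small_near_of_wOfRecord_ne_zero_of_scalars {k : ℕ} (hk : k + 1 ≤ (F.P p.K).m + (F.P p.K).K) (A₁ : ℝ) (ζ : ZetaOfRecord F N ν M)
    (hM : 1 ≤ M) (hLM₂ : ((F.P p.K).d + 4) * (F.P p.K).L + 3 ≤ (F.P p.K).L * ν.M₂) (hε : 0 < epsOfRecord ν g (k + 1))
    (hε3 : (143 * (((((F.P p.K).d + 4 : ℕ) : ℝ)) ^ 2 / 4) ^ 2) * epsOfRecord ν g (k + 1) ≤ 1 / 3)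
    (hε2 : 2 * epsOfRecord ν g (k + 1) ≤ 2 * deltaSU (Fin N) / ((((F.P p.K).d + 4) * (F.P p.K).L : ℕ) : ℝ) ^ 2)
    (s' : SeqOfRecord F ν M g p.K (k + 1)) (U : GaugeField (F.P p.K) k (SU N)) (V' : GaugeField (F.P p.K) (k + 1) (SU N))
    (hw : wOfRecord F N ν M A₁ ζ p g k s' U V' ≠ 0)
    (hcov : ∀ y ∈ s'.Ω (k + 1), ∃ c ∈ cubesIn (cubeχ F ν p g k) (s'.Ω (k + 1)), y ∈ cubeχ F ν p g k c)
    (c' : PBond (F.P p.K) (k + 1)) (hc' : embIter (k + 1) c'.src ∈ s'.Ω (k + 1) ∨ embIter (k + 1) c'.tgt ∈ s'.Ω (k + 1))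
    (q : Plaq (F.P p.K) k) (hq : blockOf q.src = c'.src.unshift c'.dir ∨ blockOf q.src = c'.src ∨ blockOf q.src = c'.tgt) :
    dist1 (GaugeField.plaqHol U q) < 4 * (2 * deltaOfRecord ν g k A₁) + 2 * (epsOfRecord ν g (k + 1) / ((F.P p.K).L : ℝ) ^ 2) :=
  plaqHol_small_near_of_wOfRecord_ne_zero F N ν M p g hk A₁ ζ (sideD_pos_of_one_le F ν M p g k hM) (collar3_le_sideχ_of F ν p g k hLM₂) hε
    (prop2_row3_div_sq_of (F.P p.K).L_pos hε.le hε3) (prop2_row2_div_sq_of (F.P p.K).L_pos hε.le hε2) s' U V' hw hcov c' hc' q hq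

end Record

end Summit.QuantumFields.YangMills.Theorems.BalabanUVNodesN11PlaqSmallOfSect3EventsNumerics

end
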